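import Summits.QuantumFields.YangMills.Theorems.ParabolicTrajectoryContinuumLimitOnTrajectoryStubTranslB
import Literature.MathematicalPhysics.QuantumFieldTheory.SchwingerLimitInheritance

/-!
# Stub `stub_transl : TranslOfUUVB` (line `two-orbit-synchronisation`, crux stmt-QuantumFields-10522) — PROVED

Work file of the stub worker (seat c2, wave 1). The registered stub `theorem stub_transl : TranslOfUUVB` — the TRANSLATION
half of E1 for the canonical curvature distributions along a scheme with polynomial volume growth and uniform-threshold
plaquette-string bounds — is proved here from the two helper files:
* helper A (`…StubTranslA`): exact torus translation invariance relocates the box; quantitative seam bound;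
* helper B (`…StubTranslB`): the seam is `o(1)` under `PolyVolumeGrowth`, uniformly over lattice vectors of bounded
  physical length (`translB_eventually_norm_translate_sub_le`), and `UUVB` bounds `curvDistribution` on `⁰𝒮` with one
  threshold (`Transl.norm_curvDistribution_le_of_uuvb`).
Assembly (`stub_transl`): for `a ∈ ℝ⁴` put `b_k = a_k ⌊a / a_k⌋` (coordinatewise), a lattice vector with `‖b_k - a‖ ≤ 2a_k → 0`
(`Transl.norm_latticeRound_sub_le`); then
`cD_k(T_a F) - cD_k F = [cD_k(T_a F) - cD_k(T_{b_k} F)] + [cD_k(T_{b_k} F) - cD_k F]`: the second bracket is the relocation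
lemma (uniform over `‖b_k‖ ≤ ‖a‖ + 1`), the first is `cD_k (T_a F - T_{b_k} F)` with `T_a F - T_{b_k} F ∈ ⁰𝒮` tending to `0` in
`𝒮` (strong continuity of translations, `continuous_translateMulti`), killed by the uniform `UUVB` bound — the
equicontinuity argument of the tree's `translateMulti_apply_eq_of_tendsto`.
-/

set_option autoImplicit false

open scoped SchwartzMap
open MeasureTheory Filter Topology
open Literature.MathematicalPhysics.QuantumFieldTheory Literature.MathematicalPhysics.QuantumLattice
open Literature.MathematicalPhysics.AQFT
open Literature.Probability.LatticeModels (Site box mem_box card_box)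
open Summit.QuantumFields.YangMills.Theses.ParabolicTrajectory

noncomputable section

namespace Summit.QuantumFields.YangMills.Cruxes.ContinuumLimitOnTrajectory.TwoOrbitSynchronisation

namespace Transl

/-- **Lattice rounding of a vector**: `‖t ⌊a/t⌋ - a‖ ≤ 2t` in `ℝ⁴` (coordinatewise floor, `t > 0`). -/
theorem norm_latticeRound_sub_le {t : ℝ} (ht : 0 < t) (a : EuclideanSpace ℝ (Fin 4)) :
    ‖t • siteToE (fun j => ⌊a j / t⌋ : Site 4) - a‖ ≤ 2 * t := by
  have hcoord : ∀ j, |t * (⌊a j / t⌋ : ℝ) - a j| ≤ t := by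
    intro j
    have h1 := Int.floor_le (a j / t)
    have h2 := Int.lt_floor_add_one (a j / t)
    have ht' : t * (a j / t) = a j := mul_div_cancel₀ _ ht.ne'
    have h3 : t * (⌊a j / t⌋ : ℝ) ≤ a j := by
      calc t * (⌊a j / t⌋ : ℝ) ≤ t * (a j / t) := mul_le_mul_of_nonneg_left h1 ht.le
        _ = a j := ht'
    have h4 : a j < t * (⌊a j / t⌋ : ℝ) + t := by
      calc a j = t * (a j / t) := ht'.symm
        _ < t * ((⌊a j / t⌋ : ℝ) + 1) := mul_lt_mul_of_pos_left h2 ht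
        _ = t * (⌊a j / t⌋ : ℝ) + t := by ring
    rw [abs_le]; constructor <;> linarith
  rw [EuclideanSpace.norm_eq]
  have hsum : ∑ j, ‖(t • siteToE (fun j => ⌊a j / t⌋ : Site 4) - a) j‖ ^ 2 ≤ ∑ _j : Fin 4, t ^ 2 :=
    Finset.sum_le_sum fun j _ => by
      rw [PiLp.sub_apply, PiLp.smul_apply, siteToE_apply, smul_eq_mul, Real.norm_eq_abs, sq_abs]
      have h := hcoord j
      rw [abs_le] at h
      nlinarith [h.1, h.2]
  calc √(∑ j, ‖(t • siteToE (fun j => ⌊a j / t⌋ : Site 4) - a) j‖ ^ 2) ≤ √(∑ _j : Fin 4, t ^ 2) :=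
        Real.sqrt_le_sqrt hsum
    _ = √((2 * t) ^ 2) := by congr 1; simp; ring
    _ = 2 * t := Real.sqrt_sq (by linarith)

end Transl

/-- **Stub `stub_transl` (registered): the translation half of E1 from uniform UV bounds.** Along a scheme with
polynomial volume growth and uniform-threshold plaquette-string bounds, translating an off-diagonal test function changes
the canonical curvature distributions by `o(1)` (`AsympTransl`): lattice part by exact torus translations (relocation of
the box seam, `o(1)` by Schwartz decay against the `a_k^{-4p}` face multiplicity), sub-lattice remainder by `UUVB` and the
strong continuity of translations on `𝒮`. -/
theorem stub_transl : TranslOfUUVB := by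
  intro G _ _ _ _ _ _ r sch hvol hU p F hF a
  obtain ⟨s, α, β, hb⟩ := Transl.norm_curvDistribution_le_of_uuvb r sch hU
  -- lattice approximants `b k = a_k ⌊a / a_k⌋ → a`
  set v : ℕ → Site 4 := fun k j => ⌊a j / sch.a k⌋ with hv
  set b : ℕ → EuclideanSpace ℝ (Fin 4) := fun k => sch.a k • siteToE (v k) with hb_def
  have hba : Tendsto b atTop (𝓝 a) := by
    refine tendsto_iff_norm_sub_tendsto_zero.2 (squeeze_zero (fun k => norm_nonneg _)
      (fun k => Transl.norm_latticeRound_sub_le (sch.a_pos k) a) ?_)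
    simpa using sch.tendsto_a.const_mul 2
  have hbR : ∀ᶠ k in atTop, ‖b k‖ ≤ ‖a‖ + 1 := by
    have h0 : Tendsto (fun k => ‖b k - a‖) atTop (𝓝 0) := tendsto_iff_norm_sub_tendsto_zero.1 hba
    filter_upwards [h0.eventually_lt_const zero_lt_one] with k hk
    calc ‖b k‖ = ‖a + (b k - a)‖ := by congr 1; abel
      _ ≤ ‖a‖ + ‖b k - a‖ := norm_add_le _ _
      _ ≤ ‖a‖ + 1 := by linarith
  -- the sub-lattice remainder: `curvDistribution k (T_a F) - curvDistribution k (T_{b k} F) → 0`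
  set Kb : ℝ := (Fintype.card PlaqIdx : ℝ) ^ p * (α * (p.factorial : ℝ) ^ β) with hKb
  have hB : Tendsto (fun k => curvDistribution r sch k p (translateMulti a F) -
      curvDistribution r sch k p (translateMulti (b k) F)) atTop (𝓝 0) := by
    have hτ : Tendsto (fun k => translateMulti (b k) F) atTop (𝓝 (translateMulti a F)) :=
      ((continuous_translateMulti F).tendsto a).comp hba
    have hqc : Continuous fun G' : 𝓢((Fin p → EuclideanSpace ℝ (Fin 4)), ℂ) => schwartzNorm (p * s) G' :=
      Seminorm.continuous_finsetSup (s := Finset.Iic (p * s, p * s)) fun i _ =>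
        (schwartz_withSeminorms ℂ (Fin p → EuclideanSpace ℝ (Fin 4)) ℂ).continuous_seminorm i
    have h1 : Tendsto (fun k => translateMulti a F - translateMulti (b k) F) atTop (𝓝 0) := by
      simpa using (tendsto_const_nhds (x := translateMulti a F)).sub hτ
    have hN : Tendsto (fun k => schwartzNorm (p * s) (translateMulti a F - translateMulti (b k) F)) atTop (𝓝 0) := by
      have h2 := (hqc.tendsto 0).comp h1
      rwa [show schwartzNorm (p * s) (0 : 𝓢((Fin p → EuclideanSpace ℝ (Fin 4)), ℂ)) = 0 from map_zero _] at h2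
    refine squeeze_zero_norm' ?_ (by simpa using hN.const_mul Kb)
    filter_upwards [hb] with k hk
    rw [← curvDistribution_sub]
    calc ‖curvDistribution r sch k p (translateMulti a F - translateMulti (b k) F)‖
        ≤ (Fintype.card PlaqIdx : ℝ) ^ p * (α * (p.factorial : ℝ) ^ β *
            schwartzNorm (p * s) (translateMulti a F - translateMulti (b k) F)) :=
          hk p _ ((hF.translateMulti a).sub (hF.translateMulti (b k)))
      _ = Kb * schwartzNorm (p * s) (translateMulti a F - translateMulti (b k) F) := by rw [hKb]; ring
  -- assembly with the relocation lemma for the lattice part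
  rw [Metric.tendsto_nhds]
  intro ε hε
  have hA := translB_eventually_norm_translate_sub_le r sch hvol p F (‖a‖ + 1) (ε / 2) (half_pos hε)
  have hB' := Metric.tendsto_nhds.1 hB (ε / 2) (half_pos hε)
  filter_upwards [hA, hB', hbR] with k hkA hkB hkR
  rw [dist_zero_right] at hkB ⊢
  have hkA' := hkA (v k) hkR
  calc ‖curvDistribution r sch k p (translateMulti a F) - curvDistribution r sch k p F‖
      = ‖(curvDistribution r sch k p (translateMulti a F) - curvDistribution r sch k p (translateMulti (b k) F)) +
          (curvDistribution r sch k p (translateMulti (b k) F) - curvDistribution r sch k p F)‖ := by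
        rw [sub_add_sub_cancel]
    _ ≤ ‖curvDistribution r sch k p (translateMulti a F) - curvDistribution r sch k p (translateMulti (b k) F)‖ +
          ‖curvDistribution r sch k p (translateMulti (b k) F) - curvDistribution r sch k p F‖ := norm_add_le _ _
    _ < ε := by linarith

end Summit.QuantumFields.YangMills.Cruxes.ContinuumLimitOnTrajectory.TwoOrbitSynchronisation

end
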